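import Summits.ResolutionOfSingularities.ResolutionOfSingularities.Theorems.PurelyInseparableDim4PureLeafSplitForms
import HarnessLib
import HarnessLib.Audit.Tags

/-!
# Purely inseparable fourfolds — SPLIT NORMAL FORMS over an ARBITRARY field of characteristic `p`
# (cell res-dim4-pi; D3d kit E_K of `HOME/res-dim4-p-10/D3c-PAPER.md` §6–§7: kit E with a finite root set `R ⊂ K` in place of `𝔽_p`)
# [OURS · counted 0 · bookkeeping identities of OUR frame, not about resolution]

Width seat `res-dim4-p-10` (g3).  Port of `…PureLeafSplitForms` (roots ranging over `ZMod p`) to any field `K`: the split form is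
`N(R, m) = ∏ᵢ ∏_{c ∈ R} (Xᵢ + C c)^{m i c}` for a finite ROOT SET `R : Finset K` common to all variables and exponents
`m : σ → K → ℕ` supported in `R` (`∀ i c, c ∉ R → m i c = 0`); no definition is introduced.

* §1 structure: `splitForm_eq_monomial_mul` (`N = x^{m(·,0)} · unit part`, the unit part has non-zero constant coefficient),
  `coeff_corner_splitForm`, `le_of_mem_support_splitForm`, **`ordAlong_splitForm`** (`ord_{(x_S)} N = Σ_{i∈S} m i 0`), and padding
  of the root set (`splitForm_subset`: enlarging `R` by roots of exponent `0` changes nothing);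
* §2 **`translate_splitForm`**: a translation by a `K`-point `b` shifts every root (`m′ i c = m i (c − bᵢ)` on the root set
  `R′ = ⋃ᵢ (R + bᵢ)`), support condition preserved (`support_shift`);
* §3 the `p`-th-power part `T(R, k) = ∏ᵢ ∏_{c∈R} (Xᵢ + C c)^{p·k i c}` is an `expand p` (freshman's dream, roots `c ↦ c^p`:
  `powPart_eq_expand`), hence inert under the cleaning; `powPart_eq_X_pow_mul` (pulling `X_j^p`).

Nothing here proves resolution of singularities in dimension ≥ 4 / characteristic `p`; counted 0; AI work, weaker than expert
review. bears_on: LADDER-RESOLUTION:D157-DOOR2 (res-dim4-pi · D3d kit E_K). Supports stmt-ResolutionOfSingularities-16155 (helper).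
-/

set_option linter.dupNamespace false

open MvPolynomial Finset

open scoped BigOperators

noncomputable section

namespace Summit.ResolutionOfSingularities.ResolutionOfSingularities.Theorems.PIDim4

namespace PureLeafK

open Literature.AlgebraicGeometry.Resolution
open Literature.AlgebraicGeometry.Resolution.Hauser2010
open CentreBlowup PthPowerFactor PureLeafNF

variable {σ : Type*} [Fintype σ] [DecidableEq σ] {K : Type*} [Field K] [DecidableEq K]

/-! ## 1. Structure of `N(R, m) = ∏ᵢ ∏_{c∈R} (Xᵢ + C c)^{m i c}` -/

omit [DecidableEq σ] [DecidableEq K] in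
/-- **Padding the root set**: roots of exponent `0` may be added. [folklore] -/
theorem splitForm_subset {R R' : Finset K} (hRR' : R ⊆ R') (m : σ → K → ℕ) (hS : ∀ i c, c ∉ R → m i c = 0) :
    (∏ i, ∏ c ∈ R', (X i + C c) ^ m i c : MvPolynomial σ K) = ∏ i, ∏ c ∈ R, (X i + C c) ^ m i c := by
  refine Finset.prod_congr rfl fun i _ => ?_
  rw [← Finset.prod_subset hRR' (fun c _ hc => by rw [hS i c hc, pow_zero])]

omit [DecidableEq σ] in
/-- **`N(R, m) = x^{m(·,0)} · ∏ᵢ ∏_{c ∈ R ∖ 0} (Xᵢ + C c)^{m i c}`** (support in `R`). [folklore] -/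
theorem splitForm_eq_monomial_mul (R : Finset K) (m : σ → K → ℕ) (hS : ∀ i c, c ∉ R → m i c = 0) :
    (∏ i, ∏ c ∈ R, (X i + C c) ^ m i c : MvPolynomial σ K) =
      monomial (Finsupp.equivFunOnFinite.symm fun i => m i 0) 1 * ∏ i, ∏ c ∈ R.erase 0, (X i + C c) ^ m i c := by
  have hsplit : ∀ i, (∏ c ∈ R, (X i + C c) ^ m i c : MvPolynomial σ K) = X i ^ m i 0 * ∏ c ∈ R.erase 0, (X i + C c) ^ m i c :=
    fun i => by
    by_cases h0 : (0 : K) ∈ R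
    · rw [← Finset.mul_prod_erase R _ h0, C_0, add_zero]
    · rw [hS i 0 h0, pow_zero, one_mul, Finset.erase_eq_of_notMem h0]
  simp_rw [hsplit]
  rw [Finset.prod_mul_distrib, monomial_eq, C_1, one_mul, Finsupp.prod_fintype _ _ (fun i => pow_zero _)]
  rfl

omit [DecidableEq σ] in
/-- The unit part has constant coefficient `∏ᵢ ∏_{c ∈ R ∖ 0} c^{m i c} ≠ 0`. [folklore] -/
theorem coeff_zero_unitPart (R : Finset K) (m : σ → K → ℕ) :
    coeff 0 (∏ i, ∏ c ∈ R.erase 0, (X i + C c) ^ m i c : MvPolynomial σ K) = ∏ i, ∏ c ∈ R.erase 0, c ^ m i c := by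
  rw [← constantCoeff_eq, map_prod]
  refine Finset.prod_congr rfl fun i _ => ?_
  rw [map_prod]
  refine Finset.prod_congr rfl fun c _ => ?_
  rw [map_pow, map_add, constantCoeff_X, constantCoeff_C, zero_add]

omit [DecidableEq σ] in
/-- **`coeff_{m(·,0)} N(R, m) = ∏ᵢ ∏_{c ∈ R ∖ 0} c^{m i c}`** (`≠ 0`). [folklore] -/
theorem coeff_corner_splitForm (R : Finset K) (m : σ → K → ℕ) (hS : ∀ i c, c ∉ R → m i c = 0) :
    coeff (Finsupp.equivFunOnFinite.symm fun i => m i 0) (∏ i, ∏ c ∈ R, (X i + C c) ^ m i c : MvPolynomial σ K) =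
      ∏ i, ∏ c ∈ R.erase 0, c ^ m i c := by
  rw [splitForm_eq_monomial_mul R m hS]
  have h := coeff_monomial_mul (0 : σ →₀ ℕ) (Finsupp.equivFunOnFinite.symm fun i => m i 0) (1 : K)
    (∏ i, ∏ c ∈ R.erase 0, (X i + C c) ^ m i c : MvPolynomial σ K)
  rw [add_zero, one_mul, coeff_zero_unitPart] at h
  exact h

omit [DecidableEq σ] in
/-- The corner coefficient is non-zero. [folklore] -/
theorem coeff_corner_splitForm_ne_zero (R : Finset K) (m : σ → K → ℕ) (hS : ∀ i c, c ∉ R → m i c = 0) :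
    coeff (Finsupp.equivFunOnFinite.symm fun i => m i 0) (∏ i, ∏ c ∈ R, (X i + C c) ^ m i c : MvPolynomial σ K) ≠ 0 := by
  rw [coeff_corner_splitForm R m hS]
  exact Finset.prod_ne_zero_iff.mpr fun i _ => Finset.prod_ne_zero_iff.mpr fun c hc =>
    pow_ne_zero _ (Finset.ne_of_mem_erase hc)

omit [DecidableEq σ] in
/-- **`x^{m(·,0)}` divides `N(R, m)` monomialwise.** [folklore] -/
theorem le_of_mem_support_splitForm (R : Finset K) (m : σ → K → ℕ) (hS : ∀ i c, c ∉ R → m i c = 0) {d : σ →₀ ℕ}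
    (hd : d ∈ (∏ i, ∏ c ∈ R, (X i + C c) ^ m i c : MvPolynomial σ K).support) :
    (Finsupp.equivFunOnFinite.symm fun i => m i 0) ≤ d := by
  rw [splitForm_eq_monomial_mul R m hS, MvPolynomial.mem_support_iff, coeff_monomial_mul'] at hd
  by_contra h
  rw [if_neg h] at hd
  exact hd rfl

omit [DecidableEq σ] in
/-- **`ord_{(x_S)} N(R, m) = Σ_{i∈S} m i 0`.** [folklore] -/
theorem ordAlong_splitForm (R : Finset K) (m : σ → K → ℕ) (hS : ∀ i c, c ∉ R → m i c = 0) (S : Finset σ) :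
    ordAlong S (∏ i, ∏ c ∈ R, (X i + C c) ^ m i c : MvPolynomial σ K) =
      (degIn S (Finsupp.equivFunOnFinite.symm fun i => m i 0) : ℕ∞) :=
  LeafStep.ordAlong_eq_degIn S (⟨∏ i, ∏ c ∈ R, (X i + C c) ^ m i c, Finsupp.equivFunOnFinite.symm fun i => m i 0, ∅⟩ : CState σ K)
    (fun _ hd => le_of_mem_support_splitForm R m hS hd) (coeff_corner_splitForm_ne_zero R m hS)

/-! ## 2. Translations shift the roots -/

omit [DecidableEq σ] in
/-- The support condition after a shift: `m′ i c = m i (c − bᵢ)` vanishes off `R′ = ⋃ᵢ (R + bᵢ)`. [folklore] -/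
theorem support_shift (R : Finset K) (m : σ → K → ℕ) (hS : ∀ i c, c ∉ R → m i c = 0) (b : σ → K) :
    ∀ i c, c ∉ Finset.univ.biUnion (fun i => R.map (addRightEmbedding (b i))) → m i (c - b i) = 0 := fun i c hc => by
  refine hS i _ fun h => hc ?_
  rw [Finset.mem_biUnion]
  refine ⟨i, Finset.mem_univ i, ?_⟩
  rw [Finset.mem_map]
  exact ⟨c - b i, h, by simp [addRightEmbedding]⟩

omit [DecidableEq σ] in
/-- **A translation by a `K`-point SHIFTS THE ROOTS**: `translate b N(R, m) = N(R′, m′)`, `m′ i c = m i (c − bᵢ)`,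
`R′ = ⋃ᵢ (R + bᵢ)`. [folklore] -/
theorem translate_splitForm (b : σ → K) (R : Finset K) (m : σ → K → ℕ) (hS : ∀ i c, c ∉ R → m i c = 0) :
    PointBlowup.translate b (∏ i, ∏ c ∈ R, (X i + C c) ^ m i c : MvPolynomial σ K) =
      ∏ i, ∏ c ∈ Finset.univ.biUnion (fun i => R.map (addRightEmbedding (b i))), (X i + C c) ^ m i (c - b i) := by
  unfold PointBlowup.translate
  rw [map_prod]
  refine Finset.prod_congr rfl fun i _ => ?_
  rw [map_prod]
  have h1 : ∀ c, aeval (fun i => (X i + C (b i) : MvPolynomial σ K)) ((X i + C c) ^ m i c) = (X i + C (c + b i)) ^ m i c :=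
    fun c => by
    rw [map_pow, map_add, aeval_X, aeval_C, map_add, algebraMap_eq]
    congr 1
    ring
  simp_rw [h1]
  -- the product over `R` re-indexed over `R + bᵢ`, then padded to `R′`
  have hsub : R.map (addRightEmbedding (b i)) ⊆ Finset.univ.biUnion (fun i => R.map (addRightEmbedding (b i))) :=
    Finset.subset_biUnion_of_mem (fun i => R.map (addRightEmbedding (b i))) (Finset.mem_univ i)
  rw [← Finset.prod_subset hsub (fun c _ hc => ?_)]
  · rw [Finset.prod_map]
    refine Finset.prod_congr rfl fun c _ => ?_
    simp [addRightEmbedding, add_sub_cancel_right]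
  · rw [hS i _ (fun h => hc (Finset.mem_map.mpr ⟨c - b i, h, by simp [addRightEmbedding]⟩)), pow_zero]

/-! ## 3. The `p`-th-power part is an `expand` -/

variable (p : ℕ) [Fact p.Prime] [CharP K p]

omit [Fintype σ] [DecidableEq σ] [DecidableEq K] in
/-- `(Xᵢ + C c)^{p·k} = expand p ((Xᵢ + C c^p)^k)` in characteristic `p`. [folklore] -/
theorem linear_pow_mul_eq_expand (i : σ) (c : K) (k : ℕ) :
    ((X i + C c) ^ (p * k) : MvPolynomial σ K) = expand p ((X i + C (c ^ p)) ^ k) := by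
  rw [pow_mul, add_pow_char, map_pow (expand p), map_add, expand_X, expand_C, map_pow]

omit [DecidableEq σ] [DecidableEq K] in
/-- **The `p`-th-power part is an `expand`**: `∏ᵢ ∏_{c∈R} (Xᵢ + C c)^{p·k i c} = expand p (∏ᵢ ∏_{c∈R} (Xᵢ + C c^p)^{k i c})`.
[folklore] -/
theorem powPart_eq_expand (R : Finset K) (k : σ → K → ℕ) :
    (∏ i, ∏ c ∈ R, (X i + C c) ^ (p * k i c) : MvPolynomial σ K) = expand p (∏ i, ∏ c ∈ R, (X i + C (c ^ p)) ^ k i c) := by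
  rw [map_prod]
  refine Finset.prod_congr rfl fun i _ => ?_
  rw [map_prod]
  refine Finset.prod_congr rfl fun c _ => ?_
  rw [linear_pow_mul_eq_expand]

omit [DecidableEq σ] [DecidableEq K] in
/-- … so all its exponents are divisible by `p`. [folklore] -/
theorem forall_dvd_of_mem_support_powPart (R : Finset K) (k : σ → K → ℕ) :
    ∀ u ∈ (∏ i, ∏ c ∈ R, (X i + C c) ^ (p * k i c) : MvPolynomial σ K).support, ∀ t, p ∣ u t := by
  rw [powPart_eq_expand p R k]
  exact forall_dvd_of_mem_support_expand p _

omit [Fact p.Prime] [CharP K p] in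
/-- **`T(R, k) = X_j^p · T(R, k − δ_{(j,0)})`** when `1 ≤ k j 0` (support in `R`). [folklore] -/
theorem powPart_eq_X_pow_mul (R : Finset K) (k : σ → K → ℕ) (hS : ∀ i c, c ∉ R → k i c = 0) {j : σ} (hj : 1 ≤ k j 0) :
    (∏ i, ∏ c ∈ R, (X i + C c) ^ (p * k i c) : MvPolynomial σ K) =
      X j ^ p * ∏ i, ∏ c ∈ R, (X i + C c) ^ (p * (if i = j ∧ c = 0 then k j 0 - 1 else k i c)) := by
  have h0 : (0 : K) ∈ R := by by_contra h; have := hS j 0 h; omega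
  rw [← Finset.mul_prod_erase Finset.univ _ (Finset.mem_univ j),
    ← Finset.mul_prod_erase Finset.univ (fun i => ∏ c ∈ R, (X i + C c : MvPolynomial σ K) ^
      (p * (if i = j ∧ c = 0 then k j 0 - 1 else k i c))) (Finset.mem_univ j)]
  have hrest : ∏ i ∈ Finset.univ.erase j, ∏ c ∈ R, (X i + C c : MvPolynomial σ K) ^ (p * k i c) =
      ∏ i ∈ Finset.univ.erase j, ∏ c ∈ R, (X i + C c : MvPolynomial σ K) ^
        (p * (if i = j ∧ c = 0 then k j 0 - 1 else k i c)) :=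
    Finset.prod_congr rfl fun i hi => Finset.prod_congr rfl fun c _ => by
      rw [if_neg (fun h => Finset.ne_of_mem_erase hi h.1)]
  rw [hrest, ← mul_assoc]
  congr 1
  rw [← Finset.mul_prod_erase R _ h0,
    ← Finset.mul_prod_erase R (fun c => (X j + C c : MvPolynomial σ K) ^
      (p * (if j = j ∧ c = 0 then k j 0 - 1 else k j c))) h0]
  have hrest' : ∏ c ∈ R.erase 0, (X j + C c : MvPolynomial σ K) ^ (p * k j c) =
      ∏ c ∈ R.erase 0, (X j + C c : MvPolynomial σ K) ^ (p * (if j = j ∧ c = 0 then k j 0 - 1 else k j c)) :=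
    Finset.prod_congr rfl fun c hc => by rw [if_neg (fun h => Finset.ne_of_mem_erase hc h.2)]
  rw [hrest', ← mul_assoc, if_pos ⟨rfl, rfl⟩, C_0, add_zero, ← pow_add]
  congr 2
  have : p * (k j 0 - 1) + p = p * k j 0 := by
    rw [Nat.mul_sub, mul_one, Nat.sub_add_cancel (Nat.le_mul_of_pos_right p hj)]
  omega

end PureLeafK

end Summit.ResolutionOfSingularities.ResolutionOfSingularities.Theorems.PIDim4

end
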